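import Summits.Schanuel.Schanuel.Theorems.RootDecomp1KGaugeResidual
import Summits.Schanuel.Schanuel.Theorems.RootDecomp1KHyper47
import Summits.Schanuel.Schanuel.Theorems.RootDecomp1KRelLiouvilleCell05
import Literature.NumberTheory.Transcendental.LindemannWeierstrassProofs

/-!
# RootDecomp1KHyper — lens 6, generation 17 «BILOG STAIRCASE CELL» (BilogStair.lean edition 2 f0528a77…, 2567 l) — part 1 (RootDecomp1KHyper53): §A the STAIRCASE LEMMA

PORT NOTE (census-1 gen 15, 2026-08-31): port of HOME/decomp-schanuel-lens-6/g17/BilogStair.lean EDITION 2 (sha256 f0528a77…5850, 2567 l; own farm rc 0 · 0 warn ·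
0 sorry · axioms std; critic ACK STATUS L1710 / L1724 / L1737: REGISTERED as the K-R20 THIRD⁗ candidate, NO credit — the cell is a typed CONDITIONAL reduction
`sb_three_zB_of : TransferI → TransferII → SB 3 zB` with `TransferI` / `TransferII` as Prop DEFS (UNDECIDED pieces with stated tests, no sorry); edition 2 adds §F–§J:
the exp-free (II.y) half of TransferII DECIDED (`caseII_expFree`, INSTRUMENT of record) and the hypothesis-free disjunction `algebraicIndependent_pi_ell_or_pi_yB`;
PORT GO LOW from ed.2, L1737) in TEN parts `RootDecomp1KHyper53`–`62`: 53 = §A staircase lemma, 54 = §B algebraic endgame + §C the cell (`HyperStair`, `gam`,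
`TransferI`, `TransferII`, the reduction), 55 = §D member `zB = i·(π, ℓ₀, y_B)` through §D.2, 56 = §D.3 `DegGrowth` + §D.4 the member's cell theorem, 57 = §E structural
certificates, 58 = §E.2 `linearIndependent_zB` + placement, 59 = appendix §F (tree imports) + §G `toPoly` machinery, 60 = §H Case II machinery (section `CaseII`),
61 = §I first part, 62 = §I `caseII_expFree` + §J member corollaries. §F.1/§F.2 of the source (the `mvlen` algebra and the determinant/resultant bounds) DROPPED for
the tree's `RootDecomp1KHyper42` §A / `RootDecomp1KHyper47` §B (import Hyper47 replaces Hyper41); `set_option linter.dupNamespace false` dropped; 55 one-line docstrings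
added; six generic one-liners private (per-part copies); statements and proofs verbatim. `--supports stmt-Schanuel-33363`; no census credit; the port carries no credit.
Nothing here proves Schanuel; rung 0. The lens's header follows.
-/

/-!
# RootDecomp1K — lens 6, generation 17: the «BILOG STAIRCASE CELL» (log-lattice of rank 2, `e^{y}` load-bearing)

HOME kernel of lens 6 (decomp-schanuel), generation 17.  Target item: `RootDecomp1K.HyperLiouvilleSchanuel`
(stmt-Schanuel-33363) at `n = 3`, inside the residual of record `UnanchoredResidual₃⁗` (critic K-R20).

THE CELL.  `z = i·(π, ℓ, y)` with `e^{iℓ} = α ∈ ℚ̄` (so `|α| = 1`), and `y` hyper-approximated by the points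
`r_k = a_k π + b_k ℓ` of the rank-2 LOG LATTICE `ℚπ + ℚℓ` (`e^{i r_k} = γ_k` ALGEBRAIC) along a STAIRCASE
`(a_k, b_k) → (Y₁, Y₂)` (alternately flat in the two directions).  The transcendence degree of the lattice field
`ℚ(π, ℓ)` is UNKNOWN (`∈ {1, 2}`: algebraic independence of two logarithms of algebraic numbers is open) and the
cell theorem is UNIFORM in it:  `SB 3 z`, i.e. `trdeg ℚ(π, ℓ, y, e^{iy}) ≥ 3`, by the DICHOTOMY
  Case I  (`π, ℓ` alg. independent): two relations `G₁(π,ℓ,y) = 0`, `G₂(π,ℓ,e^{iy}) = 0` ⟶ TRANSFER I;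
  Case II (`Φ(π,ℓ) = 0`):            one relation `G(π,y,e^{iy}) = 0` and the exact zero `Φ(π,ℓ) = 0` ⟶ TRANSFER II;
both transfers specialise `y ↦ r_k`, `e^{iy} ↦ γ_k`, eliminate `T` against the minimal polynomial of `γ_k` and `x₂`
by a resultant, and end either in a NON-ZERO integer polynomial in `π` that is hyper-small (impossible by the
tree-PROVED Nesterenko–Waldschmidt measure of `π`) or — when the resultant vanishes identically — in an EXACT
algebraic relation `F(γ_k, a_k, b_k) = 0` (`F ≠ 0` fixed).  The ALGEBRAIC ENDGAME (this file, PROVED) kills the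
latter: `deg γ_k → ∞` (bounded-house finiteness) forces `F(T, a_k, b_k) ≡ 0`, hence a non-zero `g ∈ ℤ[a,b]`
vanishing on the staircase, contradicting the STAIRCASE LEMMA.  `e^{iy}` is LOAD-BEARING (in Case II both `y`
and `e^{iy}` must contribute) — the first cell of the lineage where the exponential of the hyper-Liouville
coordinate carries transcendence degree.

CONTENTS (0 sorry; pieces tagged in NODE-g17.md):
  §A  STAIRCASE LEMMA `staircase_eval_ne_zero` (PROVED).
  §B  `Flat`, `DegGrowth`, ALGEBRAIC ENDGAME `algEndgame` (PROVED).
  §C  `HyperStair`, `gam`, the pieces `TransferI`, `TransferII` (STATED — UNDECIDED, ports of the torsion/Kummer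
      resultant bookkeeping + one new resultant step each) and the REDUCTION `sb_three_of_transfer` (PROVED).
  §D  the member `z_B = i·(π, ℓ₀, π·y_ev + ℓ₀·y_od)`, `ℓ₀ = arctan(4/3)` (`α₀ = (3+4i)/5`): `HyperStair`, `Flat`,
      `DegGrowth` PROVED ⟹ `sb_three_zB_of : TransferI → TransferII → SB 3 z_B`.
  §E  structural certificates of `z_B` (span ⊂ iℝ): `¬HasExpLatAnchor`, `¬HasPiLatAnchor`, `¬HasPiIntAnchor`
      hypothesis-free; `¬HasAlgLatAnchor` (g16 def, copied) by the tree-PROVED Hermite–Lindemann theorem.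
  EDITION 2 (2026-08-31, same generation; §A–§E byte-identical to edition 1, sections §F–§J APPENDED):
  §F  length algebra of `mvlen` and Sylvester-resultant bounds over `ℤ[x⃗]` (verbatim from g16 `AlgLatAnchor.lean`).
  §G  `toPoly : ℤ[x₁,x₂] → (ℤ[x₁])[X]`, coefficient lengths/degrees, evaluation; the measure `MvPolyMeasure ![π]`
      (tree-PROVED `polyMeasure_pi`), heights `hgt` vs numerators/denominators.
  §H  Case II machinery: the twisted polynomial `Φ̃_k` (`twist`), the eliminant `resII = Res_{x₂}(Φ̃_k, G) ∈ ℤ[x₁]`,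
      its length/degree bounds and the product formula at `x₁ = π` (PROVED).
  §I  `caseII_expFree` (PROVED — the exp-free rung of TRANSFER II DECIDED): `Φ ≠ 0`, `Φ(π, ℓ) = 0`, `HyperStair`,
      `Flat`, `b_k > 0` eventually ⟹ no `G ≠ 0 ∈ ℤ[x₁,x₂]` has `G(π, y) = 0` (in Case II `trdeg ℚ(π, y) = 2`; what
      remains of TRANSFER II is exactly «`e^{iy}` is transcendental over `ℚ(π, y)`», the inner-norm step).
  §J  member corollaries, HYPOTHESIS-FREE: `¬AlgebraicIndependent ℚ (π, ℓ₀) → AlgebraicIndependent ℚ (π, y_B)` and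
      `AlgebraicIndependent ℚ (π, ℓ₀) ∨ AlgebraicIndependent ℚ (π, y_B)`.
-/

open Complex Polynomial IntermediateField Filter
open scoped BigOperators

namespace Summit.Schanuel.Schanuel.Theorems.RootDecomp1KHyper

namespace HyperCell

namespace LatCell

namespace Bilog

/-! ## §A  The STAIRCASE LEMMA

A non-zero real polynomial in two variables does not vanish at any point `(u, v)` with `0 < u < δ`,
`0 < v ≤ u^M` — for an `M` and a `δ > 0` depending only on the polynomial.  (Isolate the monomial
`c₀ u^r v^{j₀}` with `j₀` the least `v`-exponent and `r` the least `u`-exponent among those; every other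
monomial is `≤ |c_s| u^{r+1} v^{j₀}` in the region.) -/

/-- **Staircase lemma.** -/
theorem staircase_eval_ne_zero (h : MvPolynomial (Fin 2) ℝ) (hh : h ≠ 0) :
    ∃ (M : ℕ) (δ : ℝ), 0 < δ ∧ ∀ u v : ℝ, 0 < u → u < δ → 0 < v → v ≤ u ^ M →
      MvPolynomial.eval ![u, v] h ≠ 0 := by
  classical
  have hne : h.support.Nonempty :=
    Finset.nonempty_iff_ne_empty.mpr fun h0 => hh (MvPolynomial.support_eq_empty.mp h0)
  obtain ⟨j₀, hj₀def⟩ : ∃ j₀ : ℕ, j₀ = h.support.inf' hne (fun s => s 1) := ⟨_, rfl⟩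
  set S₀ := h.support.filter (fun s => s 1 = j₀) with hS₀
  have hS₀ne : S₀.Nonempty := by
    obtain ⟨s, hs, hs'⟩ := Finset.exists_mem_eq_inf' hne (fun s : Fin 2 →₀ ℕ => s 1)
    exact ⟨s, Finset.mem_filter.mpr ⟨hs, by rw [hj₀def, hs']⟩⟩
  obtain ⟨r, hrdef⟩ : ∃ r : ℕ, r = S₀.inf' hS₀ne (fun s => s 0) := ⟨_, rfl⟩
  obtain ⟨s₀, hs₀S, hs₀r⟩ := Finset.exists_mem_eq_inf' hS₀ne (fun s : Fin 2 →₀ ℕ => s 0)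
  have hs₀supp : s₀ ∈ h.support := (Finset.mem_filter.mp hs₀S).1
  have hs₀1 : s₀ 1 = j₀ := (Finset.mem_filter.mp hs₀S).2
  have hs₀0 : s₀ 0 = r := by rw [hrdef, hs₀r]
  have hc₀ : h.coeff s₀ ≠ 0 := MvPolynomial.mem_support_iff.mp hs₀supp
  set C : ℝ := ∑ s ∈ h.support, |h.coeff s| with hC
  have hC0 : 0 < C :=
    lt_of_lt_of_le (abs_pos.mpr hc₀)
      (Finset.single_le_sum (f := fun s => |h.coeff s|) (fun s _ => abs_nonneg _) hs₀supp)
  refine ⟨r + 1, min 1 (|h.coeff s₀| / C), lt_min one_pos (div_pos (abs_pos.mpr hc₀) hC0), ?_⟩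
  intro u v hu huδ hv hvu heval
  have hu1 : u ≤ 1 := (huδ.trans_le (min_le_left _ _)).le
  have huc : u < |h.coeff s₀| / C := huδ.trans_le (min_le_right _ _)
  have hv1 : v ≤ 1 := hvu.trans (pow_le_one₀ hu.le hu1)
  -- every monomial other than `s₀` is small
  have key : ∀ s ∈ h.support, s ≠ s₀ → u ^ (s 0) * v ^ (s 1) ≤ u ^ (r + 1) * v ^ j₀ := by
    intro s hs hne'
    have hj : j₀ ≤ s 1 := by rw [hj₀def]; exact Finset.inf'_le _ hs
    rcases Nat.eq_or_lt_of_le hj with hle | hlt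
    · -- `s 1 = j₀`, so `s ∈ S₀` and `s 0 ≥ r + 1`
      have hs1 : s 1 = j₀ := hle.symm
      have hsS : s ∈ S₀ := Finset.mem_filter.mpr ⟨hs, hs1⟩
      have hr0 : r ≤ s 0 := by rw [hrdef]; exact Finset.inf'_le _ hsS
      have hs0 : r + 1 ≤ s 0 := by
        rcases Nat.eq_or_lt_of_le hr0 with h1 | h1
        · exfalso; apply hne'
          ext i
          match i with
          | 0 => rw [hs₀0, ← h1]
          | 1 => rw [hs₀1, hs1]
        · omega
      rw [hs1]
      exact mul_le_mul_of_nonneg_right (pow_le_pow_of_le_one hu.le hu1 hs0) (by positivity)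
    · calc u ^ (s 0) * v ^ (s 1) ≤ 1 * v ^ (j₀ + 1) :=
            mul_le_mul (pow_le_one₀ hu.le hu1) (pow_le_pow_of_le_one hv.le hv1 hlt)
              (by positivity) zero_le_one
        _ = v ^ j₀ * v := by ring
        _ ≤ v ^ j₀ * u ^ (r + 1) := mul_le_mul_of_nonneg_left hvu (by positivity)
        _ = u ^ (r + 1) * v ^ j₀ := by ring
  -- the evaluation as a sum over the support
  have hev : MvPolynomial.eval ![u, v] h =
      ∑ s ∈ h.support, h.coeff s * (u ^ (s 0) * v ^ (s 1)) := by
    rw [MvPolynomial.eval_eq']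
    refine Finset.sum_congr rfl fun s _ => ?_
    rw [Fin.prod_univ_two]
    rfl
  rw [hev, ← Finset.add_sum_erase _ _ hs₀supp, hs₀0, hs₀1] at heval
  have hmain : |h.coeff s₀| * (u ^ r * v ^ j₀) ≤ C * u * (u ^ r * v ^ j₀) := by
    have e1 : h.coeff s₀ * (u ^ r * v ^ j₀) =
        -∑ s ∈ h.support.erase s₀, h.coeff s * (u ^ (s 0) * v ^ (s 1)) := by linarith
    calc |h.coeff s₀| * (u ^ r * v ^ j₀) = |h.coeff s₀ * (u ^ r * v ^ j₀)| := by
          rw [abs_mul, abs_of_pos (by positivity : 0 < u ^ r * v ^ j₀)]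
      _ = |∑ s ∈ h.support.erase s₀, h.coeff s * (u ^ (s 0) * v ^ (s 1))| := by rw [e1, abs_neg]
      _ ≤ ∑ s ∈ h.support.erase s₀, |h.coeff s * (u ^ (s 0) * v ^ (s 1))| :=
          Finset.abs_sum_le_sum_abs _ _
      _ ≤ ∑ s ∈ h.support.erase s₀, |h.coeff s| * (u ^ (r + 1) * v ^ j₀) := by
          refine Finset.sum_le_sum fun s hs => ?_
          obtain ⟨hs1, hs2⟩ := Finset.mem_erase.mp hs
          rw [abs_mul, abs_of_nonneg (by positivity : 0 ≤ u ^ (s 0) * v ^ (s 1))]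
          exact mul_le_mul_of_nonneg_left (key s hs2 hs1) (abs_nonneg _)
      _ = (∑ s ∈ h.support.erase s₀, |h.coeff s|) * (u ^ (r + 1) * v ^ j₀) := by
          rw [Finset.sum_mul]
      _ ≤ C * (u ^ (r + 1) * v ^ j₀) := by
          refine mul_le_mul_of_nonneg_right ?_ (by positivity)
          exact Finset.sum_le_sum_of_subset_of_nonneg (Finset.erase_subset _ _)
            (fun _ _ _ => abs_nonneg _)
      _ = C * u * (u ^ r * v ^ j₀) := by ring
  have hpos : 0 < u ^ r * v ^ j₀ := by positivity
  have h1 : |h.coeff s₀| ≤ C * u := le_of_mul_le_mul_right hmain hpos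
  have h2 : C * u < |h.coeff s₀| := by
    have := (lt_div_iff₀ hC0).mp huc
    linarith
  linarith

end Bilog
end LatCell
end HyperCell
end Summit.Schanuel.Schanuel.Theorems.RootDecomp1KHyper
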